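import Summits.KontsevichZagierPeriods.KontsevichZagierPeriods.Theorems.RootDecompPureDefectProperConeP1

/-! # `RootDecompPureDefectProperCone` — part 2/2 of the mechanical ≤360-line split of `RootDecompPureDefectProperCone.lean`
(split by the decomp-kz census seat for landing; mathematics unchanged; part 2 continues part 1). -/

noncomputable section

namespace Summit.KontsevichZagierPeriods.RootDecompPureDefect
open Literature.NumberTheory.Transcendental Literature.NumberTheory.Transcendental.KZ
open Summit.KontsevichZagierPeriods.KontsevichZagierPeriods.Theses.RootDecompPureDefect
open MeasureTheory Set

/-- `2` is a unit of `P` (private copy; the public twin is `…Theorems.soloInformed_isUnit_two` in a module this chain does not import). -/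
private theorem two_isUnit : IsUnit (2 : FormalPeriodRing) := by
  have h := natCast_succ_isUnit 1
  rwa [Nat.cast_one, one_add_one_eq_two] at h

/-- **`ProperCone ⟹` cancellation ON SQUARES by classes of non-zero value.**  If `0 < v g` and `g·x² = 0`, then with
`(M+1)g = 1 + c` (`posCertificate`): `x² + c·x² = 0`, so `x² ∈ T ∩ −T`. -/
theorem sqCancel_of_properCone (hP : ProperCone) :
    ∀ g x : FormalPeriodRing, evalP g ≠ 0 → g * (x * x) = 0 → x * x = 0 := by
  have pos : ∀ g x : FormalPeriodRing, 0 < evalP g → g * (x * x) = 0 → x * x = 0 := by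
    intro g x hg hgx
    obtain ⟨M, c, hc, hM⟩ := posCertificate g hg
    have h1 : x * x + c * (x * x) = 0 := by
      have h2 : ((M : FormalPeriodRing) + 1) * g * (x * x) = 0 := by rw [mul_assoc, hgx, mul_zero]
      rw [hM, add_mul, one_mul] at h2
      exact h2
    have hneg : -(x * x) ∈ posCone := by
      rw [neg_eq_of_add_eq_zero_right h1]; exact mul_sq_mem_posCone hc x
    exact hP _ (sq_mem_posCone x) hneg
  intro g x hg hgx
  rcases lt_or_gt_of_ne hg with hneg | hpos
  · exact pos (-g) x (by rw [map_neg]; linarith) (by rw [neg_mul, hgx, neg_zero])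
  · exact pos g x hpos hgx

/-- **THE EDGE `ProperCone ⟹ PiConnected`** (item 31891 ⟹ item 27509): for a value-zero quasi-idempotent
`f² = ϖᵏ f`, `g := ϖᵏ − f` has value `πᵏ ≠ 0` and `g·f² = 0`, so `f² = 0`, so `ϖᵏ f = f² = 0`. -/
theorem piConnected_of_properCone (hP : ProperCone) : PiConnected := by
  rintro f ⟨k, hk⟩ hf
  refine ⟨k, ?_⟩
  change f * f = piClass ^ k * f at hk
  change piClass ^ k * f = 0
  have hg : evalP (piClass ^ k - f) ≠ 0 := by
    rw [map_sub, hf, sub_zero]; exact evalP_piClass_pow_ne_zero k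
  have h0 : (piClass ^ k - f) * (f * f) = 0 := by linear_combination (-f) * hk
  have := sqCancel_of_properCone hP _ f hg h0
  rw [← hk, this]

/-- Integer polynomials in the disc class evaluate to the same polynomials in `π`. -/
theorem evalP_polyPi (u : Polynomial ℤ) :
    evalP (Polynomial.eval₂ (Int.castRingHom FormalPeriodRing) piClass u) =
      Polynomial.eval₂ (Int.castRingHom ℝ) Real.pi u := by
  rw [Polynomial.ringHom_eval₂_intCastRingHom, evalP_piClass]

/-- **Lindemann 1882** (tree theorem `transcendental_pi_holds`): a non-zero integer polynomial does not vanish at `π`. -/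
theorem eval₂_pi_ne_zero {u : Polynomial ℤ} (hu : u ≠ 0) :
    Polynomial.eval₂ (Int.castRingHom ℝ) Real.pi u ≠ 0 := by
  intro h
  have hT : Transcendental ℤ Real.pi :=
    Transcendental.restrictScalars (R := ℤ) (S := ℚ) (A := ℝ) (algebraMap ℤ ℚ).injective_int
      transcendental_pi_holds
  refine hu ((transcendental_iff.mp hT) u ?_)
  rwa [Polynomial.aeval_def, algebraMap_int_eq]

/-- Auxiliary step `evalP_polyPi_ne_zero`. [bookkeeping] -/
theorem evalP_polyPi_ne_zero {u : Polynomial ℤ} (hu : u ≠ 0) :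
    evalP (Polynomial.eval₂ (Int.castRingHom FormalPeriodRing) piClass u) ≠ 0 := by
  rw [evalP_polyPi]; exact eval₂_pi_ne_zero hu

/-- `ProperCone ⟹ PhantomPiAlgebraic` (item 31138; `u = Xᵐ`). -/
theorem phantomPiAlgebraic_of_properCone (hP : ProperCone) : PhantomPiAlgebraic := by
  intro f k hk hf
  obtain ⟨m, hm⟩ := piConnected_of_properCone hP f ⟨k, hk⟩ hf
  refine ⟨Polynomial.X ^ m, pow_ne_zero m Polynomial.X_ne_zero, ?_⟩
  rw [Polynomial.eval₂_X_pow]; exact hm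

/-- `ProperCone ⟹ PolyPiCancellation` (item 31137; consumes Lindemann: `u(ϖ)·f = 0`, `u ≠ 0 ⟹ v f = 0`). -/
theorem polyPiCancellation_of_properCone (hP : ProperCone) : PolyPiCancellation := by
  intro f k u hk hu huf
  apply piConnected_of_properCone hP f ⟨k, hk⟩
  have h := congrArg evalP huf
  rw [map_mul, map_zero] at h
  exact (mul_eq_zero.mp h).resolve_left (by
    change evalP (Polynomial.eval₂ (Int.castRingHom FormalPeriodRing) piClass u) ≠ 0
    exact evalP_polyPi_ne_zero hu)

/-! ## 7. The Γ-facing corollary: square roots of positive value -/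

/-- **`ProperCone` decides square roots of positive value up to the root**: if `u² = w²`, `v u = v w` and `0 < v w`,
then `w·(w − u) = 0`.  Proof: with `p := w − u`, `p² = 2w·p` and `u·p = −w·p`, so `t := w·p² ∈ T` (weight `w`) and
`−t = u·p² ∈ T` (weight `u`, of the same positive value); `ProperCone` gives `w·p² = 0`, square-cancellation by `w`
gives `p² = 0 = 2w·p`, and `2 ∈ Pˣ`.  On an index-two Das pair (`ϖʲ(g² − ϖ²ⁱ) = 0`, `v g = πⁱ`; apply to
`u = ϖʲ g`, `w = ϖ^{i+j}`) this is the pair's identity up to `ϖ`-torsion. -/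
theorem sqRoot_torsion_of_properCone (hP : ProperCone) :
    ∀ u w : FormalPeriodRing, u * u = w * w → evalP u = evalP w → 0 < evalP w → w * (w - u) = 0 := by
  intro u w huw hv hw
  have hu : 0 < evalP u := by rw [hv]; exact hw
  set p : FormalPeriodRing := w - u with hp
  have hp2 : p * p = 2 * w * p := by rw [hp]; linear_combination huw
  have hup : u * p = -(w * p) := by rw [hp]; linear_combination (-1 : FormalPeriodRing) * huw
  have ht : w * (p * p) ∈ posCone := mul_sq_mem_posCone_of_pos hw p
  have hnt : -(w * (p * p)) ∈ posCone := by
    have : -(w * (p * p)) = u * (p * p) := by linear_combination (-p) * hup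
    rw [this]; exact mul_sq_mem_posCone_of_pos hu p
  have h0 : w * (p * p) = 0 := hP _ ht hnt
  have hpp : p * p = 0 := sqCancel_of_properCone hP w p hw.ne' h0
  have h2 : (2 : FormalPeriodRing) * (w * p) = 0 := by rw [← mul_assoc, ← hp2, hpp]
  obtain ⟨two, htwo⟩ := two_isUnit
  have : w * p = 0 := by
    have h3 := congrArg (fun z => (↑two⁻¹ : FormalPeriodRing) * z) h2
    simp only [mul_zero] at h3
    rwa [← mul_assoc, ← htwo, Units.inv_mul, one_mul] at h3
  rw [hp] at this
  exact this

end Summit.KontsevichZagierPeriods.RootDecompPureDefect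

end
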